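/-
Copyright (c) 2026 the pub-hodgecm-mathlib formalisation cell (harness21).  Prover seat hodgecm-mathlib-K2E3-p23 (g4), Track B «K2-LIT» ∕ h413
(`stmt-HodgeConjecture-24833`), line `K2_E3_EllipticInputs`, (SC-an) road «FC» (line lead K2E3-p14 (g4), RULINGS #15∕#18), brick (FC-8) file F3a.  2026-09-04.
-/
import Summits.HodgeConjecture.HodgeConjecture.Theorems.K2E3ConjFibreCoverSkeleton    -- ★ (FC-8a) p857179 `setLIntegral_lintegral_conj_le_tsum` (this seat)
import Summits.HodgeConjecture.HodgeConjecture.Theorems.K2E3FinConjFibreReduction    -- ★∕filed (FC-8 F2) p857272: reduction to the box with `P = Zc` (over ★ FC-A)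
import Summits.HodgeConjecture.HodgeConjecture.Theorems.K2E3DoubleCosetBoxMeasure     -- ★ (FC-B) p857173∕p857182 `measure_doubleCoset_mul_measure_box_le`, `isOpen_doubleCoset` (K2E3-p11 (g4))
import HarnessLib

/-!
# Crux `H413` — K2-LIT E3, (SC-an) road «FC» (finite conjugation measure), brick (FC-8) file F3a: THE GENERIC ASSEMBLY — (FC) FROM A BOX DECAY
# `μ(boxₙ ∩ Zc) ≤ μ(boxₙ) · εₙ` WITH `Σ εₙ < ∞`

Cell `hodgecm-mathlib`, Track B, line `K2_E3_EllipticInputs`, socket U12 :255 (SC-an) via road «FC» of K2E3-p14 (g4) (RULINGS #15 (R15-1) steps (i)(ii)(vi), #18 (R18-1)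
«FC-8 the model assembly»); seat K2E3-p23 (g4).  THEOREMS ONLY; count-neutral helper (`--supports stmt-HodgeConjecture-24833 --as helper`).  Third file of (FC-8):
everything in the assembly that does not look at matrix entries, stated for a second-countable locally compact UNIMODULAR group `G` (FC-A∕FC-B frame).

THE MATHEMATICS.  `K₀ ≤ G` compact open, `(tₙ)ₙ` with `G = ⋃ₙ K₀ tₙ K₀` (Cartan), `Ω` a `K₀`-bi-invariant set covered by finitely many left `K₀`-cosets and containing
the compact `C` and the open support `{β ≠ 0}` of the continuous `β ≤ M_b < ∞`; `boxₙ := Ω ∩ {h | tₙ h tₙ⁻¹ ∈ Ω}`, `Zc := {h | Z(h) compact}`,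
`Φ_β := {g | ∫ β(x g x⁻¹) dμ(x) < ∞}`.  Then
`∫_{C ∩ Φ_β} ∫_G β(x g x⁻¹) dμ dμ ≤ M_b Σₙ μ(K₀tₙK₀) · sup_{x ∈ K₀tₙK₀} μ((C ∩ Φ_β) ∩ {g | x g x⁻¹ ∈ {β ≠ 0}})` (★ FC-8a)
`≤ M_b Σₙ μ(K₀tₙK₀) · μ(boxₙ ∩ Zc)` (★ F2: the fibre is a conjugate of a subset of `boxₙ ∩ Zc`, ★ FC-A puts it inside `Zc`)
`≤ M_b Σₙ μ(K₀tₙK₀) μ(boxₙ) εₙ ≤ M_b |F|² μ(K₀)² Σₙ εₙ < ∞` (the HYPOTHESIS `hdecay` + ★ FC-B).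
* **`lintegral_fibre_lt_top_of_boxDecay`** — exactly this, with the decay `hdecay : ∀ n, μ(boxₙ ∩ Zc) ≤ μ(boxₙ) · εₙ`, `Σ εₙ ≠ ⊤`, as the ONE remaining input
  (discharged on the model `U(σ, Φ₃)(K)` by F3b from the lead's (FC-6b), ★ (FC-C) and (FC-5)∕(FC-D): `boxₙ ∩ Zc ⊆ boxₙ ∩ {near diagonal collision}`).
* `tsum_measure_doubleCoset_mul_le` — the summation step `Σₙ μ(K₀tₙK₀)·(μ(boxₙ)·εₙ) ≤ |F|² μ(K₀)² Σₙ εₙ`.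
* ED. 2 (append-only): `tsum_measure_doubleCoset_mul_le'`, **`lintegral_fibre_lt_top_of_boxDecay'`** — the same over ANY countable index `ι` of the cover (for the
  rank-two twin `GL₃(F) ⧸ Z = ⋃_{a ≥ b ≥ 0} K̄ t̄_{a,b} K̄` of the row-11 split road, deal (D58)).

HONEST LABEL: HC_CM is proved only modulo the 7 printed citations (2 remaining named inputs: hLiu418 = stmt-HodgeConjecture-24832, h413 =
stmt-HodgeConjecture-24833) until rung 0 closes; generic measure theory, closes no organ by itself ((SC-an) is NOT ★; (FC) on the model still needs the decay input).

## References
* [HarishChandra1970] Harish-Chandra (notes by G. van Dijk), *Harmonic Analysis on Reductive p-adic Groups*, LNM 162 (1970), Part V §3, Part VI §8 (fibre integrals,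
  `∫_{KAK}`).
* [Cartier1979] P. Cartier, *Representations of p-adic groups: a survey*, Proc. Sympos. Pure Math. 33.1 (1979), §I.3–I.4 (double cosets of a compact open subgroup).
* [Folland1995] G. B. Folland, *A Course in Abstract Harmonic Analysis* (1995), §2.2–§2.4.
-/

set_option autoImplicit false
-- the mandated namespace repeats `HodgeConjecture.HodgeConjecture`, as in every `Theorems/*.lean` of this sub-problem
set_option linter.dupNamespace false

noncomputable section

open MeasureTheory MeasureTheory.Measure Set
open scoped ENNReal Pointwise

namespace Summit.HodgeConjecture.HodgeConjecture.Cruxes.H413.K2E3FinConjOfBoxDecay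

open K2E3ConjFibreCoverSkeleton K2E3FinConjFibreReduction K2E3DoubleCosetBoxMeasure

variable {G : Type*} [Group G] [TopologicalSpace G] [IsTopologicalGroup G] [LocallyCompactSpace G] [T2Space G] [SecondCountableTopology G]
  [MeasurableSpace G] [BorelSpace G] (μ : Measure G) [μ.IsHaarMeasure] [μ.IsMulRightInvariant]

omit [T2Space G] in
/-- **THE SUMMATION STEP**: `Σₙ μ(K₀ tₙ K₀) · (μ(boxₙ) · εₙ) ≤ |F|² μ(K₀)² · Σₙ εₙ` (★ FC-B `measure_doubleCoset_mul_measure_box_le`, uniform in `n`).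
[cite: Cartier1979, §I.3–I.4] -/
theorem tsum_measure_doubleCoset_mul_le (K₀ : Subgroup G) (hKo : IsOpen (K₀ : Set G)) (t : ℕ → G) (Ω : Set G) (F : Finset G)
    (hΩF : Ω ⊆ ⋃ f ∈ F, f • (K₀ : Set G)) (ε : ℕ → ℝ≥0∞) :
    ∑' n, μ ((K₀ : Set G) * {t n} * (K₀ : Set G)) * (μ (Ω ∩ {h : G | t n * h * (t n)⁻¹ ∈ Ω}) * ε n) ≤
      (F.card : ℝ≥0∞) ^ 2 * μ K₀ ^ 2 * ∑' n, ε n := by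
  rw [← ENNReal.tsum_mul_left]
  refine ENNReal.tsum_le_tsum fun n => ?_
  rw [← mul_assoc]
  exact mul_le_mul' (measure_doubleCoset_mul_measure_box_le μ K₀ hKo (t n) Ω F hΩF) le_rfl

/-- **(FC) FROM A BOX DECAY — the generic assembly of road «FC» (steps (i), (ii), (vi) of (R15-1)).**  `G` second countable locally compact, `μ` a left AND right
invariant Haar measure, `K₀` a compact open subgroup, `G = ⋃ₙ K₀ tₙ K₀`, `Ω` `K₀`-bi-invariant, covered by the finitely many cosets `f K₀` (`f ∈ F`), containing `C`
and the open support of the continuous `β ≤ M_b < ∞`.  IF `μ(boxₙ ∩ Zc) ≤ μ(boxₙ) · εₙ` for all `n` with `Σₙ εₙ < ∞` (`boxₙ = Ω ∩ {h | tₙ h tₙ⁻¹ ∈ Ω}`,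
`Zc = {h | Z(h) compact}`), THEN `∫_{C ∩ Φ_β} ∫_G β(x g x⁻¹) dμ(x) dμ(g) < ∞`.
[cite: HarishChandra1970, Part V §3; Part VI §8] [cite: Cartier1979, §I.3–I.4] -/
theorem lintegral_fibre_lt_top_of_boxDecay (K₀ : Subgroup G) (hKo : IsOpen (K₀ : Set G)) (hKc : IsCompact (K₀ : Set G))
    (t : ℕ → G) (hcov : ∀ x : G, ∃ n, x ∈ (K₀ : Set G) * {t n} * (K₀ : Set G))
    (Ω : Set G) (hΩl : ∀ k ∈ K₀, ∀ g, k * g ∈ Ω ↔ g ∈ Ω) (hΩr : ∀ k ∈ K₀, ∀ g, g * k ∈ Ω ↔ g ∈ Ω)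
    (F : Finset G) (hΩF : Ω ⊆ ⋃ f ∈ F, f • (K₀ : Set G))
    {C : Set G} (hC : C ⊆ Ω) {β : G → ℝ≥0∞} (hβ : Continuous β) (hβΩ : ∀ g, β g ≠ 0 → g ∈ Ω) {Mb : ℝ≥0∞} (hMb : Mb ≠ ⊤) (hβM : ∀ g, β g ≤ Mb)
    (ε : ℕ → ℝ≥0∞) (hε : ∑' n, ε n ≠ ⊤)
    (hdecay : ∀ n, μ (Ω ∩ {h : G | t n * h * (t n)⁻¹ ∈ Ω} ∩ {h : G | IsCompact ((Subgroup.centralizer ({h} : Set G)) : Set G)}) ≤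
      μ (Ω ∩ {h : G | t n * h * (t n)⁻¹ ∈ Ω}) * ε n) :
    ∫⁻ g in C ∩ {g : G | ∫⁻ x, β (x * g * x⁻¹) ∂μ < ⊤}, ∫⁻ x, β (x * g * x⁻¹) ∂μ ∂μ < ⊤ := by
  -- notation
  set A : Set G := C ∩ {g : G | ∫⁻ x, β (x * g * x⁻¹) ∂μ < ⊤} with hA
  set S : Set G := {u : G | β u ≠ 0} with hS
  set Zc : Set G := {h : G | IsCompact ((Subgroup.centralizer ({h} : Set G)) : Set G)} with hZc
  have hSm : MeasurableSet S := hβ.measurable (measurableSet_singleton 0).compl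
  have hAΩ : A ⊆ Ω := fun g hg => hC hg.1
  have hSΩ : S ⊆ Ω := fun g hg => hβΩ g hg
  have hβS : ∀ g, β g ≠ 0 → g ∈ S := fun g hg => hg
  have hD : ∀ n, MeasurableSet ((K₀ : Set G) * {t n} * (K₀ : Set G)) := fun n => (isOpen_doubleCoset K₀ hKo (t n)).measurableSet
  -- step (i): ★ (FC-8a)
  have h1 := setLIntegral_lintegral_conj_le_tsum μ hD hcov A hSm hβ.measurable hβM hβS
  -- step (ii): the fibre count is at most `μ(boxₙ ∩ Zc)` (★ F2 over ★ FC-A)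
  have h2 : ∀ n, (⨆ x ∈ (K₀ : Set G) * {t n} * (K₀ : Set G), μ (A ∩ {g : G | x * g * x⁻¹ ∈ S})) ≤
      μ (Ω ∩ {h : G | t n * h * (t n)⁻¹ ∈ Ω} ∩ Zc) := by
    intro n
    refine iSup₂_le fun x hx => ?_
    exact measure_inter_conjPreimage_le_of_invariant μ K₀ (t n) x hx Ω hΩl hΩr hAΩ hSΩ
      (fun y g => conj_mem_compactCentralizer_iff y g) (fibre_subset_compactCentralizer μ hβ (fun g hg => hg.2) x)
  -- steps (ii)+(vi): the sum is at most `M_b |F|² μ(K₀)² Σ εₙ`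
  have h3 : ∑' n, μ ((K₀ : Set G) * {t n} * (K₀ : Set G)) * ⨆ x ∈ (K₀ : Set G) * {t n} * (K₀ : Set G), μ (A ∩ {g : G | x * g * x⁻¹ ∈ S}) ≤
      (F.card : ℝ≥0∞) ^ 2 * μ K₀ ^ 2 * ∑' n, ε n := by
    refine le_trans (ENNReal.tsum_le_tsum fun n => mul_le_mul' le_rfl ((h2 n).trans (hdecay n))) ?_
    exact tsum_measure_doubleCoset_mul_le μ K₀ hKo t Ω F hΩF ε
  refine lt_of_le_of_lt (h1.trans (mul_le_mul' le_rfl h3)) ?_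
  -- finiteness
  have hK : μ K₀ < ⊤ := hKc.measure_lt_top
  refine ENNReal.mul_lt_top hMb.lt_top (ENNReal.mul_lt_top (ENNReal.mul_lt_top ?_ ?_) hε.lt_top)
  · exact ENNReal.pow_lt_top (ENNReal.natCast_lt_top _)
  · exact ENNReal.pow_lt_top hK

/-! ## ED. 2 (append-only): the same assembly over ANY countable index of the Cartan cover (rank `≥ 2`: `GL₃(F) ⧸ Z` is `⋃_{a ≥ b ≥ 0} K̄ t̄_{a,b} K̄`) -/

omit [T2Space G] in
/-- **THE SUMMATION STEP over a countable index `ι`**: `Σᵢ μ(K₀ tᵢ K₀) · (μ(boxᵢ) · εᵢ) ≤ |F|² μ(K₀)² · Σᵢ εᵢ` (★ FC-B, uniform in `i`). [cite: Cartier1979, §I.3–I.4] -/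
theorem tsum_measure_doubleCoset_mul_le' {ι : Type*} (K₀ : Subgroup G) (hKo : IsOpen (K₀ : Set G)) (t : ι → G) (Ω : Set G) (F : Finset G)
    (hΩF : Ω ⊆ ⋃ f ∈ F, f • (K₀ : Set G)) (ε : ι → ℝ≥0∞) :
    ∑' i, μ ((K₀ : Set G) * {t i} * (K₀ : Set G)) * (μ (Ω ∩ {h : G | t i * h * (t i)⁻¹ ∈ Ω}) * ε i) ≤
      (F.card : ℝ≥0∞) ^ 2 * μ K₀ ^ 2 * ∑' i, ε i := by
  rw [← ENNReal.tsum_mul_left]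
  refine ENNReal.tsum_le_tsum fun i => ?_
  rw [← mul_assoc]
  exact mul_le_mul' (measure_doubleCoset_mul_measure_box_le μ K₀ hKo (t i) Ω F hΩF) le_rfl

/-- **(FC) FROM A BOX DECAY, COUNTABLE INDEX** — the generic assembly of road «FC» for a Cartan-type cover `G = ⋃ᵢ K₀ tᵢ K₀` indexed by any countable `ι`
(for `GL₃(F) ⧸ Z`: `ι = {(a, b) : b ≤ a}`, `t_{a,b} = diag(ϖ^{−a}, ϖ^{−b}, 1)`): IF `μ(boxᵢ ∩ Zc) ≤ μ(boxᵢ) · εᵢ` for all `i` with `Σᵢ εᵢ < ∞`, THEN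
`∫_{C ∩ Φ_β} ∫_G β(x g x⁻¹) dμ(x) dμ(g) < ∞` (same proof as `lintegral_fibre_lt_top_of_boxDecay`, which is the case `ι = ℕ`).
[cite: HarishChandra1970, Part V §3; Part VI §8] [cite: Cartier1979, §I.3–I.4] -/
theorem lintegral_fibre_lt_top_of_boxDecay' {ι : Type*} [Countable ι] (K₀ : Subgroup G) (hKo : IsOpen (K₀ : Set G)) (hKc : IsCompact (K₀ : Set G))
    (t : ι → G) (hcov : ∀ x : G, ∃ i, x ∈ (K₀ : Set G) * {t i} * (K₀ : Set G))
    (Ω : Set G) (hΩl : ∀ k ∈ K₀, ∀ g, k * g ∈ Ω ↔ g ∈ Ω) (hΩr : ∀ k ∈ K₀, ∀ g, g * k ∈ Ω ↔ g ∈ Ω)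
    (F : Finset G) (hΩF : Ω ⊆ ⋃ f ∈ F, f • (K₀ : Set G))
    {C : Set G} (hC : C ⊆ Ω) {β : G → ℝ≥0∞} (hβ : Continuous β) (hβΩ : ∀ g, β g ≠ 0 → g ∈ Ω) {Mb : ℝ≥0∞} (hMb : Mb ≠ ⊤) (hβM : ∀ g, β g ≤ Mb)
    (ε : ι → ℝ≥0∞) (hε : ∑' i, ε i ≠ ⊤)
    (hdecay : ∀ i, μ (Ω ∩ {h : G | t i * h * (t i)⁻¹ ∈ Ω} ∩ {h : G | IsCompact ((Subgroup.centralizer ({h} : Set G)) : Set G)}) ≤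
      μ (Ω ∩ {h : G | t i * h * (t i)⁻¹ ∈ Ω}) * ε i) :
    ∫⁻ g in C ∩ {g : G | ∫⁻ x, β (x * g * x⁻¹) ∂μ < ⊤}, ∫⁻ x, β (x * g * x⁻¹) ∂μ ∂μ < ⊤ := by
  set A : Set G := C ∩ {g : G | ∫⁻ x, β (x * g * x⁻¹) ∂μ < ⊤} with hA
  set S : Set G := {u : G | β u ≠ 0} with hS
  set Zc : Set G := {h : G | IsCompact ((Subgroup.centralizer ({h} : Set G)) : Set G)} with hZc
  have hSm : MeasurableSet S := hβ.measurable (measurableSet_singleton 0).compl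
  have hAΩ : A ⊆ Ω := fun g hg => hC hg.1
  have hSΩ : S ⊆ Ω := fun g hg => hβΩ g hg
  have hβS : ∀ g, β g ≠ 0 → g ∈ S := fun g hg => hg
  have hD : ∀ i, MeasurableSet ((K₀ : Set G) * {t i} * (K₀ : Set G)) := fun i => (isOpen_doubleCoset K₀ hKo (t i)).measurableSet
  have h1 := setLIntegral_lintegral_conj_le_tsum μ hD hcov A hSm hβ.measurable hβM hβS
  have h2 : ∀ i, (⨆ x ∈ (K₀ : Set G) * {t i} * (K₀ : Set G), μ (A ∩ {g : G | x * g * x⁻¹ ∈ S})) ≤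
      μ (Ω ∩ {h : G | t i * h * (t i)⁻¹ ∈ Ω} ∩ Zc) := by
    intro i
    refine iSup₂_le fun x hx => ?_
    exact measure_inter_conjPreimage_le_of_invariant μ K₀ (t i) x hx Ω hΩl hΩr hAΩ hSΩ
      (fun y g => conj_mem_compactCentralizer_iff y g) (fibre_subset_compactCentralizer μ hβ (fun g hg => hg.2) x)
  have h3 : ∑' i, μ ((K₀ : Set G) * {t i} * (K₀ : Set G)) * ⨆ x ∈ (K₀ : Set G) * {t i} * (K₀ : Set G), μ (A ∩ {g : G | x * g * x⁻¹ ∈ S}) ≤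
      (F.card : ℝ≥0∞) ^ 2 * μ K₀ ^ 2 * ∑' i, ε i := by
    refine le_trans (ENNReal.tsum_le_tsum fun i => mul_le_mul' le_rfl ((h2 i).trans (hdecay i))) ?_
    exact tsum_measure_doubleCoset_mul_le' μ K₀ hKo t Ω F hΩF ε
  refine lt_of_le_of_lt (h1.trans (mul_le_mul' le_rfl h3)) ?_
  have hK : μ K₀ < ⊤ := hKc.measure_lt_top
  refine ENNReal.mul_lt_top hMb.lt_top (ENNReal.mul_lt_top (ENNReal.mul_lt_top ?_ ?_) hε.lt_top)
  · exact ENNReal.pow_lt_top (ENNReal.natCast_lt_top _)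
  · exact ENNReal.pow_lt_top hK

omit [T2Space G] in
/-- **(FC-8 F3a‴) THE ASSEMBLY OVER AN ADMISSIBLE DOMAIN** (ED. 3, for the transfers along central quotients of road «GL-[M6]-sc»): same data as F3a′, but the
integration domain is ANY `A ⊆ C` such that every `g ∈ A` whose orbit meets `{β ≠ 0}` has compact centraliser (`A = C ∩ {fibre < ⊤}` is F3a′ by ★ F2
`fibre_subset_compactCentralizer`; `A = C ∩ {Z(g) compact}` is the compact-centraliser form): `∫⁻_{A} ∫⁻ β(x g x⁻¹) dx dg < ⊤`.  Proof = F3a′'s verbatim with the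
admissibility hypothesis in place of ★ F2. [cite: HarishChandra1970, Part VII §2 p. 69] -/
theorem lintegral_fibre_lt_top_of_boxDecay_of_admissible {ι : Type*} [Countable ι] (K₀ : Subgroup G) (hKo : IsOpen (K₀ : Set G)) (hKc : IsCompact (K₀ : Set G))
    (t : ι → G) (hcov : ∀ x : G, ∃ i, x ∈ (K₀ : Set G) * {t i} * (K₀ : Set G))
    (Ω : Set G) (hΩl : ∀ k ∈ K₀, ∀ g, k * g ∈ Ω ↔ g ∈ Ω) (hΩr : ∀ k ∈ K₀, ∀ g, g * k ∈ Ω ↔ g ∈ Ω)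
    (F : Finset G) (hΩF : Ω ⊆ ⋃ f ∈ F, f • (K₀ : Set G))
    {C : Set G} (hC : C ⊆ Ω) {β : G → ℝ≥0∞} (hβ : Continuous β) (hβΩ : ∀ g, β g ≠ 0 → g ∈ Ω) {Mb : ℝ≥0∞} (hMb : Mb ≠ ⊤) (hβM : ∀ g, β g ≤ Mb)
    (ε : ι → ℝ≥0∞) (hε : ∑' i, ε i ≠ ⊤)
    (hdecay : ∀ i, μ (Ω ∩ {h : G | t i * h * (t i)⁻¹ ∈ Ω} ∩ {h : G | IsCompact ((Subgroup.centralizer ({h} : Set G)) : Set G)}) ≤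
      μ (Ω ∩ {h : G | t i * h * (t i)⁻¹ ∈ Ω}) * ε i)
    {A : Set G} (hAC : A ⊆ C)
    (hAZ : ∀ x : G, ∀ g ∈ A, x * g * x⁻¹ ∈ {u : G | β u ≠ 0} → g ∈ {h : G | IsCompact ((Subgroup.centralizer ({h} : Set G)) : Set G)}) :
    ∫⁻ g in A, ∫⁻ x, β (x * g * x⁻¹) ∂μ ∂μ < ⊤ := by
  set S : Set G := {u : G | β u ≠ 0} with hS
  set Zc : Set G := {h : G | IsCompact ((Subgroup.centralizer ({h} : Set G)) : Set G)} with hZc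
  have hSm : MeasurableSet S := hβ.measurable (measurableSet_singleton 0).compl
  have hAΩ : A ⊆ Ω := fun g hg => hC (hAC hg)
  have hSΩ : S ⊆ Ω := fun g hg => hβΩ g hg
  have hβS : ∀ g, β g ≠ 0 → g ∈ S := fun g hg => hg
  have hD : ∀ i, MeasurableSet ((K₀ : Set G) * {t i} * (K₀ : Set G)) := fun i => (isOpen_doubleCoset K₀ hKo (t i)).measurableSet
  have h1 := setLIntegral_lintegral_conj_le_tsum μ hD hcov A hSm hβ.measurable hβM hβS
  have h2 : ∀ i, (⨆ x ∈ (K₀ : Set G) * {t i} * (K₀ : Set G), μ (A ∩ {g : G | x * g * x⁻¹ ∈ S})) ≤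
      μ (Ω ∩ {h : G | t i * h * (t i)⁻¹ ∈ Ω} ∩ Zc) := by
    intro i
    refine iSup₂_le fun x hx => ?_
    exact measure_inter_conjPreimage_le_of_invariant μ K₀ (t i) x hx Ω hΩl hΩr hAΩ hSΩ
      (fun y g => conj_mem_compactCentralizer_iff y g) (hAZ x)
  have h3 : ∑' i, μ ((K₀ : Set G) * {t i} * (K₀ : Set G)) * ⨆ x ∈ (K₀ : Set G) * {t i} * (K₀ : Set G), μ (A ∩ {g : G | x * g * x⁻¹ ∈ S}) ≤
      (F.card : ℝ≥0∞) ^ 2 * μ K₀ ^ 2 * ∑' i, ε i := by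
    refine le_trans (ENNReal.tsum_le_tsum fun i => mul_le_mul' le_rfl ((h2 i).trans (hdecay i))) ?_
    exact tsum_measure_doubleCoset_mul_le' μ K₀ hKo t Ω F hΩF ε
  refine lt_of_le_of_lt (h1.trans (mul_le_mul' le_rfl h3)) ?_
  have hK : μ K₀ < ⊤ := hKc.measure_lt_top
  refine ENNReal.mul_lt_top hMb.lt_top (ENNReal.mul_lt_top (ENNReal.mul_lt_top ?_ ?_) hε.lt_top)
  · exact ENNReal.pow_lt_top (ENNReal.natCast_lt_top _)
  · exact ENNReal.pow_lt_top hK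

omit [T2Space G] in
/-- **(FC-8 F3a‴, compact-centraliser domain)**: under F3a′'s data, `∫⁻_{C ∩ {Z(g) compact}} ∫⁻ β(x g x⁻¹) dx dg < ⊤` — the form that transfers along central
quotients with compact kernel (road «GL-[M6]-sc», B1∕B3). [cite: HarishChandra1970, Part VII §2 p. 69] -/
theorem lintegral_fibre_lt_top_of_boxDecay_cc {ι : Type*} [Countable ι] (K₀ : Subgroup G) (hKo : IsOpen (K₀ : Set G)) (hKc : IsCompact (K₀ : Set G))
    (t : ι → G) (hcov : ∀ x : G, ∃ i, x ∈ (K₀ : Set G) * {t i} * (K₀ : Set G))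
    (Ω : Set G) (hΩl : ∀ k ∈ K₀, ∀ g, k * g ∈ Ω ↔ g ∈ Ω) (hΩr : ∀ k ∈ K₀, ∀ g, g * k ∈ Ω ↔ g ∈ Ω)
    (F : Finset G) (hΩF : Ω ⊆ ⋃ f ∈ F, f • (K₀ : Set G))
    {C : Set G} (hC : C ⊆ Ω) {β : G → ℝ≥0∞} (hβ : Continuous β) (hβΩ : ∀ g, β g ≠ 0 → g ∈ Ω) {Mb : ℝ≥0∞} (hMb : Mb ≠ ⊤) (hβM : ∀ g, β g ≤ Mb)
    (ε : ι → ℝ≥0∞) (hε : ∑' i, ε i ≠ ⊤)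
    (hdecay : ∀ i, μ (Ω ∩ {h : G | t i * h * (t i)⁻¹ ∈ Ω} ∩ {h : G | IsCompact ((Subgroup.centralizer ({h} : Set G)) : Set G)}) ≤
      μ (Ω ∩ {h : G | t i * h * (t i)⁻¹ ∈ Ω}) * ε i) :
    ∫⁻ g in C ∩ {h : G | IsCompact ((Subgroup.centralizer ({h} : Set G)) : Set G)}, ∫⁻ x, β (x * g * x⁻¹) ∂μ ∂μ < ⊤ :=
  lintegral_fibre_lt_top_of_boxDecay_of_admissible μ K₀ hKo hKc t hcov Ω hΩl hΩr F hΩF hC hβ hβΩ hMb hβM ε hε hdecay Set.inter_subset_left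
    (fun _ _ hg _ => hg.2)

end Summit.HodgeConjecture.HodgeConjecture.Cruxes.H413.K2E3FinConjOfBoxDecay

end
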